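import Summits.ABC.IUTFork.Cor312LicenceExactContentM
import Literature.IUT.LogVolume.TensorPacketLicenceCellOrders
import Literature.IUT.LogVolume.UnitLogTorsionFreeBallCriterion
import Literature.IUT.LogVolume.DifferentEstimatesCorollaries
import HarnessLib

/-!
# [IUTchIII] Cor. 3.12, Step (xi-f): the licence at the M-LEVEL setting of record in INTEGER ORDERS at one place —
# `Licence ⟹ e·⌊(M − j·D − (j+1)·R_in)/e⌋ + (j+1)·R_out ≤ m_q` at every place `v̲ ∈ V̲`, every label `j = i+1`

PROOF-ONLY record file (D-0012; no definitions, no `Prop` facts, no instances) of the abc-iut cell (WAVE-5 prover seat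
abc-iut-w5-d166, gen 7; D-0079 R-W «WINDOW Θ-SIDE INEQUALITY», lane U, row «W:M-U2-ORDERS», HOME/STATUS 2026-08-26T19:46:47Z;
sequel of this lineage's `Cor312LicenceExactContentM` (p459449) / `…MGenuine` (p459746); the M-SETTING twin, in abc-iut-w5-d180's
integer-orders currency (`TensorPacketLicenceCellOrders`, p459071), of the NECESSITY half of abc-iut-w4-d036's K-setting
«U2-LICENCE-WRAPPER»). TAKES NO SIDE on [IUTchIII] Cor. 3.12 (S. Mochizuki, *Inter-universal Teichmüller theory III*, kurims
manuscript, Cor. 3.12 p. 173 l. 41 – p. 174 l. 19; Step (xi-f) p. 184 l. 26–29) or on any author.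

OBJECT: abc-iut-c312-1's `Thm311ToCor312.Licence` («at every label `j = i+1 ∈ 𝔽_l^⋇` and every `v_ℚ` the q-pilot region lies in
the holomorphic hull `ⁿ˒°𝒰_{j,v_ℚ}` of the possible images of the Θ-pilot») at abc-iut-s2-p8's summand-route M-LEVEL sharp setting
`Thm311.Real.settingPrVolSharpM D hlog t tq …` (genuine carriers `K_{v̲}`, `v̲ ∈ V̲`, [IUTchI] Def. 3.1 (e); Θ-idele binders `t`,
q-idele binders `tq`; OUR typed (Ind1)/(Ind2)/(Ind3)).

WHAT IS PROVED (namespace `Summit.ABC.IUTFork.Thm311.Real`; `p = p_u`, `K_{x₀} = kOfM D p u _ x₀`, `e = e(K_{x₀}/ℚ_p)`):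
* §2 **`norm_le_of_qRegion_subset_thetaHull_settingPrVolSharpM_diag`** — PER-PLACE necessity at the DIAGONAL summand: if
  `qRegion (j,u) ⊆ ⁿ˒°𝒰_{j,u}` then for ONE member `x₀` of the fibre, an inner radius `cin₀` of `log_p(𝒪^×_{K_{x₀}})`
  (abc-iut-c312-5's binders `hin0`/`hin`/`hmax`) and an outer radius `cout₀` (`houtΛ`/`hdom`) — witnesses needed AT `x₀` ONLY
  (p459449 §3 asked for them at every place) —
  `∀ m ∈ ℤ, p^m·‖t_{Θ,j,x₀}‖ ≤ p^{−j·d_{K_{x₀}}}·‖cin₀‖^{j+1} → p^m·‖t_{q,x₀}‖ ≤ ‖cout₀‖^{j+1}`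
  (`d_I − min_J d_{L_J} = j·d_K` at the diagonal packet `(K_{x₀})^{⊗(j+1)}`, abc-iut-w6-d018 / abc-iut-w5-d180
  `dSum_sub_inf_differentOrd_dFac_const`; the outer radii at the other members exist unconditionally, `exists_norm_isMaxOn_logUnits`);
* §3 **`orders_of_qRegion_subset_thetaHull_settingPrVolSharpM`** — the same in INTEGER ORDERS: norm uniformiser `ϖ` of
  `K_{x₀}`, `d_{K_{x₀}} = D/e`, `‖cin₀‖ = ‖ϖ‖^{R_in}`, `‖cout₀‖ = ‖ϖ‖^{R_out}`, `‖t_{Θ,j,x₀}‖ = ‖ϖ‖^{M}`, `‖t_{q,x₀}‖ = ‖ϖ‖^{m_q}`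
  ⟹ `e·((M − j·D − (j+1)·R_in) / e) + (j+1)·R_out ≤ m_q` (`/` = `Int` floor division) — abc-iut-w5-d180's predicate
  (`iota_smul_subset_packetHull_orbit_iota_smul_iff_orders`) read at the M setting; ANY local type (wild, `p = 2`, `(p−1) ∣ e`);
* §4 **`orders_of_licence_settingPrVolSharpM`** / **`not_licence_settingPrVolSharpM_of_orders`** — the licence level (`j = i+1`):
  `Licence ⟹` the predicate at every `(u, i, x₀)` carrying such witnesses; one place violating it refutes the licence;
* §5 **`not_licence_settingPrVolSharpM_of_tame_orders`** — TAME member (`p > 2`, `e ≤ p − 2`, so `log_p(𝒪^×) = 𝔪`,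
  `R_in = R_out = 1`, `D = e − 1`): `m_q < e·((M − 1)/e) + 1 − (i+1)·(e − 1) ⟹ ¬Licence` — the M twin of the (→) half of
  abc-iut-w4-d006's `licence_settingDHVolSharp_iff_of_tame_orders` (p445547).
Part 2 (`Cor312LicenceExactOrdersMGenuine`) reads these at the datum's OWN ideles (`M = (i+1)²·m_q`): the form the M rows of the
R-W WINDOW-TABLE consume (abc-iut-C-cert-3's M-line certificates p445989 / p451523 / p453684 / p453767).

HONEST SCOPE (numbers, not adjectives). NECESSITY direction only: at the M setting the converse («predicate at every bad member ⟹
Licence») is NOT claimed — at a MIXED summand `v⃗` (pairwise non-isomorphic `K_{v̲_a}` over one `p`) the exact cell needs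
`min_J d_{L_J}` for the composita of non-conjugate completions, which the tree evaluates only for pairwise-isomorphic slots
(abc-iut-w5-d180 `TensorPacketLicenceCellConjugate`); for the tame uniform case this is Abhyankar's lemma (not in the tree), for the
K line abc-iut-w5-d180's (Ind2)-movers did the job (`licence_settingDHVolSharp_of_tame_orders`), which have no `presAtM` twin yet.
The licence is a STRONGER-THAN-PRINT set-level reading of Step (xi-f) (ADJUDICATION-SPEC §2 (G1′)); OUR sharp containers
(Θ-regions constant in `m`) and typed (Ind1)/(Ind2)/(Ind3); nothing here bears on the printed GLOBAL inequality or on the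
NUMBER-level `Cor22.Cor312AtDatum`; the existence of initial Θ-data realising any hypothesis is NOT claimed; refuted-as-typed ≠
refuted-in-print. [cite: Mochizuki2012, IUTchIII Cor. 3.12 p. 173–174, Step (xi) p. 183–184; Thm. 3.11 (i) (Ind1)(Ind2) p. 154;
IUTchIV Prop. 1.1 p. 9, Prop. 1.2 (i)(ii) p. 10; IUTchI Def. 3.1 (e) p. 62] [cite: DupuyHilado2025, §3.4, §3.9, §4.9, §4.12]
[cite: NeukirchANT1999, Ch. II (5.5)] [cite: SerreLocalFields1979, Ch. III §6 Prop. 13] [claim: Mochizuki2012, status: disputed]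
for every IUT sentence quoted. typed ≠ proved (these: proved); instantiated ≠ endorsed.
-/

noncomputable section

open Set Function NumberField IsDedekindDomain
open scoped Pointwise

namespace Summit.ABC.IUTFork.Thm311.Real

open Cor312 Cor312Vol Literature.IUT.LogThetaLattice Literature.IUT.LogVolume Literature.IUT.HodgeTheaters
  Literature.NumberTheory.NumberFields Literature.NumberTheory.GaloisRepresentations.Ultrametric

/-! ## §1. Integer heart (abc-iut-w5-d180's `forall_int_mul_le_imp_iff_ediv`, which is file-private there) -/

/-- **`(∀ m, m·e ≤ N → e·m + R ≤ q) ⟺ e·(N / e) + R ≤ q`** for `0 < e` (`/` = `Int` floor division): the largest admissible `m` is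
`N / e`. [folklore] -/
theorem forall_int_mul_le_imp_iff_ediv_orders {e : ℤ} (he : 0 < e) (N R q : ℤ) :
    (∀ m : ℤ, m * e ≤ N → e * m + R ≤ q) ↔ e * (N / e) + R ≤ q := by
  constructor
  · intro h
    exact h (N / e) (Int.ediv_mul_le N he.ne')
  · intro h m hm
    have hm' : m ≤ N / e := Int.le_ediv_of_mul_le he hm
    nlinarith

/-- **Tame shape of the orders predicate** (`D = e − 1`, `R_in = R_out = 1`, `j = i+1`, `|I| = i+2`):
`e·((M − (i+1)(e−1) − (i+2))/e) + (i+2) ≤ m_q ⟺ e·((M−1)/e) + 1 − (i+1)(e−1) ≤ m_q` (abc-iut-w5-d180's `orders_predicate_tame_iff` in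
the cast shape used below). [folklore] -/
theorem orders_predicate_tame_iff_succ {e : ℤ} (he : e ≠ 0) (M mq : ℤ) (i : ℕ) :
    e * ((M - ((i : ℤ) + 1) * (e - 1) - ((i : ℤ) + 2) * 1) / e) + ((i : ℤ) + 2) * 1 ≤ mq ↔
      e * ((M - 1) / e) + 1 - ((i : ℤ) + 1) * (e - 1) ≤ mq := by
  have h : M - ((i : ℤ) + 1) * (e - 1) - ((i : ℤ) + 2) * 1 = (M - 1) + (-((i : ℤ) + 1)) * e := by ring
  have h' : e * ((M - 1) / e + -((i : ℤ) + 1)) + ((i : ℤ) + 2) * 1 = e * ((M - 1) / e) + 1 - ((i : ℤ) + 1) * (e - 1) := by ring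
  rw [h, Int.add_mul_ediv_right _ _ he, h']

variable {F K Fbar : Type} [Field F] [NumberField F] [Field K] [NumberField K] [Algebra F K]
  [Field Fbar] [Algebra F Fbar] [Algebra K Fbar] {E : WeierstrassCurve F} [E.IsElliptic] {l : ℕ}
  {Pb : BadPlacePredicates K} (D : InitialThetaData F K Fbar E l Pb) {logvK : PadicLogsVal K}
  (hlog : LogvAnalyticVal logvK)
  (t : ∀ (u : FinitePlace ℚ) (_ : Fin (thetaIndexOfInitial D).lstar) (x : (thetaIndexOfInitial D).Fibre (Val.non u)),
    kOfM D (ratChar u) u (natCast_ratChar_mem u) x)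
  (tq : ∀ (u : FinitePlace ℚ) (x : (thetaIndexOfInitial D).Fibre (Val.non u)),
    kOfM D (ratChar u) u (natCast_ratChar_mem u) x)
  (M : Type) [Field M] [NumberField M]
  (archPk : ∀ (j : (thetaIndexOfInitial D).Label) (vQ : (thetaIndexOfInitial D).VQ),
    Set ((logShellsOfInitialDH D logvK).Packet j vQ))
  (archSub : ∀ (j : (thetaIndexOfInitial D).Label) (v : (thetaIndexOfInitial D).V),
    Set ((logShellsOfInitialDH D logvK).Packet j ((thetaIndexOfInitial D).over v)))
  (Ψ : ℤ → ∀ v : (thetaIndexOfInitial D).V, v ∈ (thetaIndexOfInitial D).Vbad →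
    Set ((logShellsOfInitialDH D logvK).StarPacket v))
  (act : ℤ → ∀ v : (thetaIndexOfInitial D).V, v ∈ (thetaIndexOfInitial D).Vbad →
    (logShellsOfInitialDH D logvK).StarPacket v → Module.End ℚ ((logShellsOfInitialDH D logvK).StarPacket v))
  (Mmod : ℤ → ∀ j : (thetaIndexOfInitial D).LabelStar, Set ((logShellsOfInitialDH D logvK).GlobalPacket j.1))
  (region : ℤ → ∀ j : (thetaIndexOfInitial D).LabelStar, FinDivisor M → ∀ vQ : (thetaIndexOfInitial D).VQ,
    Set ((logShellsOfInitialDH D logvK).Packet j.1 vQ))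
  (n : ℤ) {HT : Type} {LogLink : HT → HT → Type} {IsFull : ∀ {s t : HT}, LogLink s t → Prop}
  (lat : LGPGaussianLogThetaLattice LogLink IsFull)
  {Frd : Type} {IsoF : Frd → Frd → Type} {Ob : Frd → Type} {realify : Frd → Frd} {Strip : Type}
  {IsoS : Strip → Strip → Type}
  {Mv : ∀ v : (thetaIndexOfInitial D).V, v ∈ (thetaIndexOfInitial D).Vbad → Type} [∀ v h, Monoid (Mv v h)]
  (sig : GlobalLGPFrobenioidSignature (thetaIndexOfInitial D).lstar (thetaIndexOfInitial D).V
    (· ∈ (thetaIndexOfInitial D).Vbad) Frd IsoF Ob realify Strip IsoS Mv)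
  (split : SplittingMonoids Mv) {ObΔ : Type}
  {N : ∀ v : (thetaIndexOfInitial D).V, v ∈ (thetaIndexOfInitial D).Vbad → Type} [∀ v h, Monoid (N v h)]
  (qData : QPilotData ObΔ N)
  (htq0 : ∀ u x, tq u x ≠ 0) (Sq : Finset (FinitePlace ℚ))
  (htq1 : ∀ (u : FinitePlace ℚ) (x : (thetaIndexOfInitial D).Fibre (Val.non u)), u ∉ Sq → ‖tq u x‖ = 1)

/-! ## §2. Per-place necessity at the diagonal summand (norm form, no field factor left) -/

/-- **NECESSITY AT ONE PLACE, DIAGONAL SUMMAND.** Non-zero Θ-ideles; ONE member `x₀` of the fibre of `V̲` over `u`, an inner radius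
`cin₀` of `log_p(𝒪^×_{K_{x₀}})` (`cin₀ ≠ 0`, `cin₀·𝒪 ⊆ log_p(𝒪^×)`, some `w ∉ log_p(𝒪^×)` with `‖w‖·‖ϖ‖ ≤ ‖cin₀‖`) and an outer radius
`cout₀ ∈ log_p(𝒪^×_{K_{x₀}})` of largest norm. IF `qRegion (j,u) ⊆ ⁿ˒°𝒰_{j,u}` at the M-level setting of record, THEN for every `m ∈ ℤ`:
`p^m·‖t_{Θ,j,x₀}‖ ≤ p^{−j·d_{K_{x₀}}}·‖cin₀‖^{j+1} ⟹ p^m·‖t_{q,x₀}‖ ≤ ‖cout₀‖^{j+1}` — the exact cell of p459449 §3 at the DIAGONAL summand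
`v⃗ = (x₀,…,x₀)` (there `d_I − min_J d_{L_J} = j·d_{K_{x₀}}`, abc-iut-w5-d180 `dSum_sub_inf_differentOrd_dFac_const`), with radius witnesses
asked at `x₀` ONLY (outer radii at the other members exist, `exists_norm_isMaxOn_logUnits`, and do not enter).
[cite: Mochizuki2012, IUTchIII Cor. 3.12 Step (xi-f) p. 184; IUTchIV Prop. 1.1 p. 9, Prop. 1.2 (i)(ii) p. 10]
[cite: DupuyHilado2025, §3.9, §4.9, §4.12] -/
theorem norm_le_of_qRegion_subset_thetaHull_settingPrVolSharpM_diag (ht0 : ∀ u i x, t u i x ≠ 0)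
    (j : (thetaIndexOfInitial D).Label) (u : FinitePlace ℚ) (x₀ : (thetaIndexOfInitial D).Fibre (Val.non u))
    {cin₀ cout₀ : kOfM D (ratChar u) u (natCast_ratChar_mem u) x₀} (hin0 : cin₀ ≠ 0)
    (hin : ∀ o : kOfM D (ratChar u) u (natCast_ratChar_mem u) x₀, ‖o‖ ≤ 1 →
      cin₀ * o ∈ logUnits (kOfM D (ratChar u) u (natCast_ratChar_mem u) x₀))
    (hmax : ∃ (ϖ : (kOfM D (ratChar u) u (natCast_ratChar_mem u) x₀)ˣ) (w : kOfM D (ratChar u) u (natCast_ratChar_mem u) x₀),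
      IsUniformizer ϖ ∧ w ∉ logUnits (kOfM D (ratChar u) u (natCast_ratChar_mem u) x₀) ∧
        ‖w‖ * ‖(ϖ : kOfM D (ratChar u) u (natCast_ratChar_mem u) x₀)‖ ≤ ‖cin₀‖)
    (houtΛ : cout₀ ∈ logUnits (kOfM D (ratChar u) u (natCast_ratChar_mem u) x₀))
    (hdom : ∀ z ∈ logUnits (kOfM D (ratChar u) u (natCast_ratChar_mem u) x₀), ‖z‖ ≤ ‖cout₀‖)
    (h : (settingPrVolSharpM D hlog t tq M archPk archSub Ψ act Mmod region n lat sig split qData htq0 Sq htq1).qRegion j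
        (Val.non u) ⊆
      (settingPrVolSharpM D hlog t tq M archPk archSub Ψ act Mmod region n lat sig split qData htq0 Sq htq1).thetaHull j (Val.non u))
    (m : ℤ)
    (hm : (ratChar u : ℝ) ^ m * ‖(presAtM D hlog u).labelIdele (t u) j x₀‖ ≤
      (ratChar u : ℝ) ^ (-(((j : ℕ) : ℝ) * differentOrd (ratChar u) (kOfM D (ratChar u) u (natCast_ratChar_mem u) x₀))) *
        ‖cin₀‖ ^ ((j : ℕ) + 1)) :
    (ratChar u : ℝ) ^ m * ‖tq u x₀‖ ≤ ‖cout₀‖ ^ ((j : ℕ) + 1) := by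
  classical
  haveI : Nonempty ((thetaIndexOfInitial D).Caps j) := ⟨0⟩
  -- outer radii at every member of the fibre: the given one at `x₀`, any one elsewhere
  have hex : ∀ x : (thetaIndexOfInitial D).Fibre (Val.non u),
      ∃ z ∈ logUnits (kOfM D (ratChar u) u (natCast_ratChar_mem u) x),
        ∀ w ∈ logUnits (kOfM D (ratChar u) u (natCast_ratChar_mem u) x), ‖w‖ ≤ ‖z‖ :=
    fun x => exists_norm_isMaxOn_logUnits (ratChar u) (kOfM D (ratChar u) u (natCast_ratChar_mem u) x)
  choose z hz hzmax using hex
  set cout : ∀ x : (thetaIndexOfInitial D).Fibre (Val.non u), kOfM D (ratChar u) u (natCast_ratChar_mem u) x :=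
    Function.update z x₀ cout₀ with hcout
  have hcout₀ : cout x₀ = cout₀ := by rw [hcout, Function.update_self]
  have houtΛ' : ∀ x, cout x ∈ logUnits (kOfM D (ratChar u) u (natCast_ratChar_mem u) x) := by
    intro x
    by_cases hx : x = x₀
    · subst hx
      rw [hcout₀]
      exact houtΛ
    · rw [hcout, Function.update_of_ne hx]
      exact hz x
  have hdom' : ∀ x, ∀ w ∈ logUnits (kOfM D (ratChar u) u (natCast_ratChar_mem u) x), ‖w‖ ≤ ‖cout x‖ := by
    intro x
    by_cases hx : x = x₀
    · subst hx
      rw [hcout₀]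
      exact hdom
    · rw [hcout, Function.update_of_ne hx]
      exact hzmax x
  -- the content-free criterion of p459449 at the diagonal summand `(x₀,…,x₀)`
  have key := (qRegion_subset_thetaHull_settingPrVolSharpM_iff D hlog t tq M archPk archSub Ψ act Mmod region n lat sig split
    qData htq0 Sq htq1 ht0 j u cout houtΛ' hdom').mp h (fun _ => x₀) m
  rw [Finset.prod_const, Finset.card_univ, Fintype.card_fin, hcout₀] at key
  refine key (Set.iUnion_subset fun a => ?_)
  -- each slot box at the diagonal summand has the displayed content (abc-iut-c312-5's exact cell, `∀ J` collapsed to `min_J`)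
  refine (iota_smul_normalizedPacket_subset_zpow_smul_logPacket_iff (ratChar u) ((presAtM D hlog u).kk fun _ => x₀)
    (c := fun _ => cin₀) (fun _ => hin0) (fun _ => hin) (fun _ => hmax) a _ m).mpr ?_
  have hC : (0 : ℝ) ≤ ∏ _b : (thetaIndexOfInitial D).Caps j, ‖cin₀‖ := Finset.prod_nonneg fun _ _ => norm_nonneg _
  refine (forall_dFac_le_rpow_mul_iff_inf (ratChar u) (fun _ : (thetaIndexOfInitial D).Caps j => (presAtM D hlog u).k x₀)
    hC).mpr ?_
  rw [dSum_sub_inf_differentOrd_dFac_const (ratChar u) ((presAtM D hlog u).k x₀), Finset.prod_const, Finset.card_univ,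
    Fintype.card_fin]
  have hcast : ((((j : ℕ) + 1 : ℕ) : ℝ) - 1) = ((j : ℕ) : ℝ) := by push_cast; ring
  rw [hcast]
  exact hm

/-! ## §3. Integer orders at the diagonal summand -/

/-- **THE CELL'S NECESSITY IN INTEGER ORDERS, M SETTING.** Same situation; a norm uniformiser `ϖ` of `K_{x₀}` (`‖ϖ‖ = p^{−1/e}`),
`d_{K_{x₀}} = D/e`, `‖cin₀‖ = ‖ϖ‖^{R_in}`, `‖cout₀‖ = ‖ϖ‖^{R_out}`, `‖t_{Θ,j,x₀}‖ = ‖ϖ‖^{M}`, `‖t_{q,x₀}‖ = ‖ϖ‖^{m_q}`. IF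
`qRegion (j,u) ⊆ ⁿ˒°𝒰_{j,u}` THEN **`e·((M − j·D − (j+1)·R_in) / e) + (j+1)·R_out ≤ m_q`** (abc-iut-w5-d180's per-summand predicate,
`iota_smul_subset_packetHull_orbit_iota_smul_iff_orders`, `|I| = j+1`). Any local type. [cite: Mochizuki2012, IUTchIV Prop. 1.1 p. 9,
Prop. 1.2 (i)(ii) p. 10; IUTchIII Cor. 3.12 Step (xi-f) p. 184] [cite: DupuyHilado2025, §4.9, §4.12] [cite: NeukirchANT1999, Ch. II (5.5)] -/
theorem orders_of_qRegion_subset_thetaHull_settingPrVolSharpM (ht0 : ∀ u i x, t u i x ≠ 0)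
    (j : (thetaIndexOfInitial D).Label) (u : FinitePlace ℚ) (x₀ : (thetaIndexOfInitial D).Fibre (Val.non u))
    {ϖ : (kOfM D (ratChar u) u (natCast_ratChar_mem u) x₀)ˣ} (hϖ : IsUniformizer ϖ) {Dx : ℕ}
    (hD : differentOrd (ratChar u) (kOfM D (ratChar u) u (natCast_ratChar_mem u) x₀) =
      (Dx : ℝ) / absRamificationIdx (ratChar u) (kOfM D (ratChar u) u (natCast_ratChar_mem u) x₀))
    {cin₀ cout₀ : kOfM D (ratChar u) u (natCast_ratChar_mem u) x₀}
    (hin : ∀ o : kOfM D (ratChar u) u (natCast_ratChar_mem u) x₀, ‖o‖ ≤ 1 →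
      cin₀ * o ∈ logUnits (kOfM D (ratChar u) u (natCast_ratChar_mem u) x₀))
    (hmax : ∃ (ϖ' : (kOfM D (ratChar u) u (natCast_ratChar_mem u) x₀)ˣ) (w : kOfM D (ratChar u) u (natCast_ratChar_mem u) x₀),
      IsUniformizer ϖ' ∧ w ∉ logUnits (kOfM D (ratChar u) u (natCast_ratChar_mem u) x₀) ∧
        ‖w‖ * ‖(ϖ' : kOfM D (ratChar u) u (natCast_ratChar_mem u) x₀)‖ ≤ ‖cin₀‖)
    (houtΛ : cout₀ ∈ logUnits (kOfM D (ratChar u) u (natCast_ratChar_mem u) x₀))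
    (hdom : ∀ z ∈ logUnits (kOfM D (ratChar u) u (natCast_ratChar_mem u) x₀), ‖z‖ ≤ ‖cout₀‖)
    {Rin Rout Mx mq : ℤ} (hRin : ‖cin₀‖ = ‖(ϖ : kOfM D (ratChar u) u (natCast_ratChar_mem u) x₀)‖ ^ Rin)
    (hRout : ‖cout₀‖ = ‖(ϖ : kOfM D (ratChar u) u (natCast_ratChar_mem u) x₀)‖ ^ Rout)
    (hΘ : ‖(presAtM D hlog u).labelIdele (t u) j x₀‖ = ‖(ϖ : kOfM D (ratChar u) u (natCast_ratChar_mem u) x₀)‖ ^ Mx)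
    (hq : ‖tq u x₀‖ = ‖(ϖ : kOfM D (ratChar u) u (natCast_ratChar_mem u) x₀)‖ ^ mq)
    (h : (settingPrVolSharpM D hlog t tq M archPk archSub Ψ act Mmod region n lat sig split qData htq0 Sq htq1).qRegion j
        (Val.non u) ⊆
      (settingPrVolSharpM D hlog t tq M archPk archSub Ψ act Mmod region n lat sig split qData htq0 Sq htq1).thetaHull j (Val.non u)) :
    (absRamificationIdx (ratChar u) (kOfM D (ratChar u) u (natCast_ratChar_mem u) x₀) : ℤ) *
        ((Mx - ((j : ℕ) : ℤ) * (Dx : ℤ) - (((j : ℕ) : ℤ) + 1) * Rin) /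
          (absRamificationIdx (ratChar u) (kOfM D (ratChar u) u (natCast_ratChar_mem u) x₀) : ℤ)) +
      (((j : ℕ) : ℤ) + 1) * Rout ≤ mq := by
  set e : ℕ := absRamificationIdx (ratChar u) (kOfM D (ratChar u) u (natCast_ratChar_mem u) x₀) with he_def
  have he0 : (0 : ℤ) < (e : ℤ) := by exact_mod_cast absRamificationIdx_pos (ratChar u) _
  have heR : (e : ℝ) ≠ 0 := by exact_mod_cast (absRamificationIdx_pos (ratChar u) (kOfM D (ratChar u) u (natCast_ratChar_mem u) x₀)).ne'
  have hϖ0 : 0 < ‖(ϖ : kOfM D (ratChar u) u (natCast_ratChar_mem u) x₀)‖ := norm_pos_iff.2 ϖ.ne_zero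
  have hin0 : cin₀ ≠ 0 := by
    rw [← norm_pos_iff, hRin]; exact zpow_pos hϖ0 _
  -- §2 in norm form, for every `m`
  have key : ∀ m : ℤ, m * (e : ℤ) ≤ Mx - ((j : ℕ) : ℤ) * (Dx : ℤ) - (((j : ℕ) : ℤ) + 1) * Rin →
      (e : ℤ) * m + (((j : ℕ) : ℤ) + 1) * Rout ≤ mq := by
    intro m hm
    have hnorm := norm_le_of_qRegion_subset_thetaHull_settingPrVolSharpM_diag D hlog t tq M archPk archSub Ψ act Mmod region n
      lat sig split qData htq0 Sq htq1 ht0 j u x₀ hin0 hin hmax houtΛ hdom h m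
    rw [hΘ, hq, hRin, hRout] at hnorm
    -- the antecedent in integers
    have hL : (ratChar u : ℝ) ^ m * ‖(ϖ : kOfM D (ratChar u) u (natCast_ratChar_mem u) x₀)‖ ^ Mx ≤
        (ratChar u : ℝ) ^ (-(((j : ℕ) : ℝ) * differentOrd (ratChar u) (kOfM D (ratChar u) u (natCast_ratChar_mem u) x₀))) *
          (‖(ϖ : kOfM D (ratChar u) u (natCast_ratChar_mem u) x₀)‖ ^ Rin) ^ ((j : ℕ) + 1) := by
      rw [zpow_mul_norm_zpow_le_iff (ratChar u) hϖ m Mx Rin _ ((j : ℕ) + 1), hD]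
      have h1 : -(((j : ℕ) : ℝ) * ((Dx : ℝ) / (e : ℝ))) * (e : ℝ) = -(((j : ℕ) : ℝ) * Dx) := by field_simp
      rw [← he_def, h1]
      have h2 : ((m * (e : ℤ) : ℤ) : ℝ) ≤ ((Mx - ((j : ℕ) : ℤ) * (Dx : ℤ) - (((j : ℕ) : ℤ) + 1) * Rin : ℤ) : ℝ) := by
        exact_mod_cast hm
      push_cast at h2 ⊢
      linarith
    have hR := hnorm hL
    -- the conclusion in integers
    have h3 := zpow_mul_norm_zpow_le_iff (ratChar u) hϖ m mq Rout 0 ((j : ℕ) + 1)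
    rw [neg_zero, Real.rpow_zero, one_mul, ← he_def] at h3
    have h4 := h3.mp hR
    have h5 : (((e : ℤ) * m + (((j : ℕ) : ℤ) + 1) * Rout : ℤ) : ℝ) ≤ ((mq : ℤ) : ℝ) := by
      push_cast at h4 ⊢
      linarith
    exact_mod_cast h5
  exact (forall_int_mul_le_imp_iff_ediv_orders he0 _ _ _).mp key

/-! ## §4. The licence level (`j = i+1 ∈ 𝔽_l^⋇`) -/

/-- **THE (xi-f) LICENCE AT THE M SETTING ⟹ THE ORDERS PREDICATE AT EVERY PLACE.** For non-zero Θ-ideles: if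
`Thm311ToCor312.Licence (settingPrVolSharpM …)` holds, then at every finite rational place `u`, every label `i+1` and every member
`x₀` of the fibre carrying a uniformiser `ϖ`, `d = D/e`, and inner/outer radius witnesses `‖cin₀‖ = ‖ϖ‖^{R_in}`, `‖cout₀‖ = ‖ϖ‖^{R_out}`
with `‖t_{Θ,i,x₀}‖ = ‖ϖ‖^M`, `‖t_{q,x₀}‖ = ‖ϖ‖^{m_q}`: **`e·((M − (i+1)·D − (i+2)·R_in) / e) + (i+2)·R_out ≤ m_q`.** For the q-pinned reading
the licence IS the branch-C binder S_H on `𝔽_l^⋇` (abc-iut-w5-d068 `licence_of_pilotKummerCompatHull`).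
[cite: Mochizuki2012, IUTchIII Cor. 3.12 p. 173–174, Step (xi-f) p. 184] [cite: DupuyHilado2025, §4.9, §4.12] -/
theorem orders_of_licence_settingPrVolSharpM (ht0 : ∀ u i x, t u i x ≠ 0)
    (hL : Thm311ToCor312.Licence
      (settingPrVolSharpM D hlog t tq M archPk archSub Ψ act Mmod region n lat sig split qData htq0 Sq htq1))
    (u : FinitePlace ℚ) (i : Fin (thetaIndexOfInitial D).lstar) (x₀ : (thetaIndexOfInitial D).Fibre (Val.non u))
    {ϖ : (kOfM D (ratChar u) u (natCast_ratChar_mem u) x₀)ˣ} (hϖ : IsUniformizer ϖ) {Dx : ℕ}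
    (hD : differentOrd (ratChar u) (kOfM D (ratChar u) u (natCast_ratChar_mem u) x₀) =
      (Dx : ℝ) / absRamificationIdx (ratChar u) (kOfM D (ratChar u) u (natCast_ratChar_mem u) x₀))
    {cin₀ cout₀ : kOfM D (ratChar u) u (natCast_ratChar_mem u) x₀}
    (hin : ∀ o : kOfM D (ratChar u) u (natCast_ratChar_mem u) x₀, ‖o‖ ≤ 1 →
      cin₀ * o ∈ logUnits (kOfM D (ratChar u) u (natCast_ratChar_mem u) x₀))
    (hmax : ∃ (ϖ' : (kOfM D (ratChar u) u (natCast_ratChar_mem u) x₀)ˣ) (w : kOfM D (ratChar u) u (natCast_ratChar_mem u) x₀),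
      IsUniformizer ϖ' ∧ w ∉ logUnits (kOfM D (ratChar u) u (natCast_ratChar_mem u) x₀) ∧
        ‖w‖ * ‖(ϖ' : kOfM D (ratChar u) u (natCast_ratChar_mem u) x₀)‖ ≤ ‖cin₀‖)
    (houtΛ : cout₀ ∈ logUnits (kOfM D (ratChar u) u (natCast_ratChar_mem u) x₀))
    (hdom : ∀ z ∈ logUnits (kOfM D (ratChar u) u (natCast_ratChar_mem u) x₀), ‖z‖ ≤ ‖cout₀‖)
    {Rin Rout Mx mq : ℤ} (hRin : ‖cin₀‖ = ‖(ϖ : kOfM D (ratChar u) u (natCast_ratChar_mem u) x₀)‖ ^ Rin)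
    (hRout : ‖cout₀‖ = ‖(ϖ : kOfM D (ratChar u) u (natCast_ratChar_mem u) x₀)‖ ^ Rout)
    (hΘ : ‖t u i x₀‖ = ‖(ϖ : kOfM D (ratChar u) u (natCast_ratChar_mem u) x₀)‖ ^ Mx)
    (hq : ‖tq u x₀‖ = ‖(ϖ : kOfM D (ratChar u) u (natCast_ratChar_mem u) x₀)‖ ^ mq) :
    (absRamificationIdx (ratChar u) (kOfM D (ratChar u) u (natCast_ratChar_mem u) x₀) : ℤ) *
        ((Mx - ((i : ℕ) + 1 : ℕ) * (Dx : ℤ) - ((i : ℕ) + 2 : ℕ) * Rin) /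
          (absRamificationIdx (ratChar u) (kOfM D (ratChar u) u (natCast_ratChar_mem u) x₀) : ℤ)) +
      ((i : ℕ) + 2 : ℕ) * Rout ≤ mq := by
  have hj : ((Setting.labelSucc i : (thetaIndexOfInitial D).Label) : ℕ) = (i : ℕ) + 1 := by
    simp [Setting.labelSucc]
  have hΘ' : ‖(presAtM D hlog u).labelIdele (t u) (Setting.labelSucc i) x₀‖ =
      ‖(ϖ : kOfM D (ratChar u) u (natCast_ratChar_mem u) x₀)‖ ^ Mx := by
    rw [PadicPresentation.labelIdele_labelSucc]; exact hΘ
  have key := orders_of_qRegion_subset_thetaHull_settingPrVolSharpM D hlog t tq M archPk archSub Ψ act Mmod region n lat sig split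
    qData htq0 Sq htq1 ht0 (Setting.labelSucc i) u x₀ hϖ hD hin hmax houtΛ hdom hRin hRout hΘ' hq (hL i (Val.non u))
  rw [hj] at key
  have hc1 : ((((i : ℕ) + 1 : ℕ) : ℤ) + 1) = (((i : ℕ) + 2 : ℕ) : ℤ) := by push_cast; ring
  rw [hc1] at key
  exact key

/-- **ONE PLACE VIOLATING THE ORDERS PREDICATE REFUTES THE LICENCE AT THE M SETTING** (the [U2]-type column of the R-W WINDOW-TABLE
at the M-level setting of record; sharper than the [STAR] socket off tame places, since `R_in`/`R_out` are the EXACT lattice radii).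
[cite: Mochizuki2012, IUTchIII Cor. 3.12 Step (xi-f) p. 184; IUTchIV Prop. 1.2 (i)(ii) p. 10] [cite: DupuyHilado2025, §4.9, §4.12] -/
theorem not_licence_settingPrVolSharpM_of_orders (ht0 : ∀ u i x, t u i x ≠ 0)
    (u : FinitePlace ℚ) (i : Fin (thetaIndexOfInitial D).lstar) (x₀ : (thetaIndexOfInitial D).Fibre (Val.non u))
    {ϖ : (kOfM D (ratChar u) u (natCast_ratChar_mem u) x₀)ˣ} (hϖ : IsUniformizer ϖ) {Dx : ℕ}
    (hD : differentOrd (ratChar u) (kOfM D (ratChar u) u (natCast_ratChar_mem u) x₀) =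
      (Dx : ℝ) / absRamificationIdx (ratChar u) (kOfM D (ratChar u) u (natCast_ratChar_mem u) x₀))
    {cin₀ cout₀ : kOfM D (ratChar u) u (natCast_ratChar_mem u) x₀}
    (hin : ∀ o : kOfM D (ratChar u) u (natCast_ratChar_mem u) x₀, ‖o‖ ≤ 1 →
      cin₀ * o ∈ logUnits (kOfM D (ratChar u) u (natCast_ratChar_mem u) x₀))
    (hmax : ∃ (ϖ' : (kOfM D (ratChar u) u (natCast_ratChar_mem u) x₀)ˣ) (w : kOfM D (ratChar u) u (natCast_ratChar_mem u) x₀),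
      IsUniformizer ϖ' ∧ w ∉ logUnits (kOfM D (ratChar u) u (natCast_ratChar_mem u) x₀) ∧
        ‖w‖ * ‖(ϖ' : kOfM D (ratChar u) u (natCast_ratChar_mem u) x₀)‖ ≤ ‖cin₀‖)
    (houtΛ : cout₀ ∈ logUnits (kOfM D (ratChar u) u (natCast_ratChar_mem u) x₀))
    (hdom : ∀ z ∈ logUnits (kOfM D (ratChar u) u (natCast_ratChar_mem u) x₀), ‖z‖ ≤ ‖cout₀‖)
    {Rin Rout Mx mq : ℤ} (hRin : ‖cin₀‖ = ‖(ϖ : kOfM D (ratChar u) u (natCast_ratChar_mem u) x₀)‖ ^ Rin)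
    (hRout : ‖cout₀‖ = ‖(ϖ : kOfM D (ratChar u) u (natCast_ratChar_mem u) x₀)‖ ^ Rout)
    (hΘ : ‖t u i x₀‖ = ‖(ϖ : kOfM D (ratChar u) u (natCast_ratChar_mem u) x₀)‖ ^ Mx)
    (hq : ‖tq u x₀‖ = ‖(ϖ : kOfM D (ratChar u) u (natCast_ratChar_mem u) x₀)‖ ^ mq)
    (hlt : mq < (absRamificationIdx (ratChar u) (kOfM D (ratChar u) u (natCast_ratChar_mem u) x₀) : ℤ) *
        ((Mx - ((i : ℕ) + 1 : ℕ) * (Dx : ℤ) - ((i : ℕ) + 2 : ℕ) * Rin) /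
          (absRamificationIdx (ratChar u) (kOfM D (ratChar u) u (natCast_ratChar_mem u) x₀) : ℤ)) +
      ((i : ℕ) + 2 : ℕ) * Rout) :
    ¬ Thm311ToCor312.Licence
      (settingPrVolSharpM D hlog t tq M archPk archSub Ψ act Mmod region n lat sig split qData htq0 Sq htq1) := fun hL =>
  absurd (orders_of_licence_settingPrVolSharpM D hlog t tq M archPk archSub Ψ act Mmod region n lat sig split qData htq0 Sq htq1 ht0
    hL u i x₀ hϖ hD hin hmax houtΛ hdom hRin hRout hΘ hq) (not_le.mpr hlt)

/-! ## §5. Tame members: `R_in = R_out = 1`, `D = e − 1` -/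

/-- **TAME MEMBER: the M twin of the (→) half of abc-iut-w4-d006's `licence_settingDHVolSharp_iff_of_tame_orders`.** Non-zero Θ-ideles;
a member `x₀` of the fibre over `u` with `p_u > 2` and `e = e(K_{x₀}/ℚ_p) ≤ p_u − 2` (so `log_p(𝒪^×_{K_{x₀}}) = 𝔪`, [IUTchIV] Prop. 1.2 (i)
equality case, and `d_{K_{x₀}} = (e−1)/e`); a norm uniformiser `ϖ` with `‖t_{Θ,i,x₀}‖ = ‖ϖ‖^M`, `‖t_{q,x₀}‖ = ‖ϖ‖^{m_q}`. THEN
`m_q < e·((M − 1)/e) + 1 − (i+1)·(e − 1) ⟹ ¬ Licence`. Nothing is assumed at any other member or place.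
[cite: Mochizuki2012, IUTchIV Prop. 1.2 (i)(ii)(iii) p. 10–11; IUTchIII Cor. 3.12 Step (xi-f) p. 184] [cite: NeukirchANT1999, Ch. II (5.5)]
[cite: SerreLocalFields1979, Ch. III §6 Prop. 13] -/
theorem not_licence_settingPrVolSharpM_of_tame_orders (ht0 : ∀ u i x, t u i x ≠ 0)
    (u : FinitePlace ℚ) (i : Fin (thetaIndexOfInitial D).lstar) (x₀ : (thetaIndexOfInitial D).Fibre (Val.non u))
    (hp2 : 2 < ratChar u)
    (he : absRamificationIdx (ratChar u) (kOfM D (ratChar u) u (natCast_ratChar_mem u) x₀) ≤ ratChar u - 2)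
    {ϖ : (kOfM D (ratChar u) u (natCast_ratChar_mem u) x₀)ˣ} (hϖ : IsUniformizer ϖ) {Mx mq : ℤ}
    (hΘ : ‖t u i x₀‖ = ‖(ϖ : kOfM D (ratChar u) u (natCast_ratChar_mem u) x₀)‖ ^ Mx)
    (hq : ‖tq u x₀‖ = ‖(ϖ : kOfM D (ratChar u) u (natCast_ratChar_mem u) x₀)‖ ^ mq)
    (hlt : mq < (absRamificationIdx (ratChar u) (kOfM D (ratChar u) u (natCast_ratChar_mem u) x₀) : ℤ) *
        ((Mx - 1) / (absRamificationIdx (ratChar u) (kOfM D (ratChar u) u (natCast_ratChar_mem u) x₀) : ℤ)) + 1 -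
      ((i : ℤ) + 1) * ((absRamificationIdx (ratChar u) (kOfM D (ratChar u) u (natCast_ratChar_mem u) x₀) : ℤ) - 1)) :
    ¬ Thm311ToCor312.Licence
      (settingPrVolSharpM D hlog t tq M archPk archSub Ψ act Mmod region n lat sig split qData htq0 Sq htq1) := by
  set e : ℕ := absRamificationIdx (ratChar u) (kOfM D (ratChar u) u (natCast_ratChar_mem u) x₀) with he_def
  have he1 : 1 ≤ e := absRamificationIdx_pos (ratChar u) _
  have hpe : ¬ ratChar u ∣ e := Nat.not_dvd_of_pos_of_lt he1 (by omega)
  -- `log_p(𝒪^×) = 𝔪 = closedBall 0 ‖ϖ‖`: the uniformiser is an inner AND an outer radius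
  have hball := TorsionFree.logUnits_eq_closedBall_of_le_sub_two (ratChar u) hϖ hp2 he
  have hϖ1 : ‖(ϖ : kOfM D (ratChar u) u (natCast_ratChar_mem u) x₀)‖ < 1 := hϖ.1
  have hin : ∀ o : kOfM D (ratChar u) u (natCast_ratChar_mem u) x₀, ‖o‖ ≤ 1 →
      (ϖ : kOfM D (ratChar u) u (natCast_ratChar_mem u) x₀) * o ∈
        logUnits (kOfM D (ratChar u) u (natCast_ratChar_mem u) x₀) := fun o ho => by
    rw [hball, Metric.mem_closedBall, dist_zero_right, norm_mul]
    exact mul_le_of_le_one_right (norm_nonneg _) ho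
  have hmax : ∃ (ϖ' : (kOfM D (ratChar u) u (natCast_ratChar_mem u) x₀)ˣ) (w : kOfM D (ratChar u) u (natCast_ratChar_mem u) x₀),
      IsUniformizer ϖ' ∧ w ∉ logUnits (kOfM D (ratChar u) u (natCast_ratChar_mem u) x₀) ∧
        ‖w‖ * ‖(ϖ' : kOfM D (ratChar u) u (natCast_ratChar_mem u) x₀)‖ ≤
          ‖(ϖ : kOfM D (ratChar u) u (natCast_ratChar_mem u) x₀)‖ := by
    refine ⟨ϖ, 1, hϖ, ?_, by rw [norm_one, one_mul]⟩
    rw [hball, Metric.mem_closedBall, dist_zero_right, norm_one, not_le]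
    exact hϖ1
  have houtΛ : (ϖ : kOfM D (ratChar u) u (natCast_ratChar_mem u) x₀) ∈ logUnits (kOfM D (ratChar u) u (natCast_ratChar_mem u) x₀) := by
    rw [hball, Metric.mem_closedBall, dist_zero_right]
  have hdom : ∀ z ∈ logUnits (kOfM D (ratChar u) u (natCast_ratChar_mem u) x₀),
      ‖z‖ ≤ ‖(ϖ : kOfM D (ratChar u) u (natCast_ratChar_mem u) x₀)‖ := fun z hz => by
    rw [hball, Metric.mem_closedBall, dist_zero_right] at hz
    exact hz
  -- `d_{K_{x₀}} = (e − 1)/e`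
  have hD : differentOrd (ratChar u) (kOfM D (ratChar u) u (natCast_ratChar_mem u) x₀) = ((e - 1 : ℕ) : ℝ) / e := by
    rw [differentOrd_eq_of_not_dvd (ratChar u) (kOfM D (ratChar u) u (natCast_ratChar_mem u) x₀) hpe, ← he_def, Nat.cast_sub he1,
      Nat.cast_one]
  refine not_licence_settingPrVolSharpM_of_orders D hlog t tq M archPk archSub Ψ act Mmod region n lat sig split qData htq0 Sq
    htq1 ht0 u i x₀ hϖ hD hin hmax houtΛ hdom (Rin := 1) (Rout := 1) (by rw [zpow_one]) (by rw [zpow_one]) hΘ hq ?_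
  -- the tame shape of the predicate
  rw [← he_def]
  have he0 : (e : ℤ) ≠ 0 := by exact_mod_cast (show e ≠ 0 by omega)
  have hshape := orders_predicate_tame_iff_succ he0 Mx mq (i : ℕ)
  have hc1 : ((((i : ℕ) + 1 : ℕ) : ℤ)) = ((i : ℕ) : ℤ) + 1 := by push_cast; ring
  have hc2 : ((((i : ℕ) + 2 : ℕ) : ℤ)) = ((i : ℕ) : ℤ) + 2 := by push_cast; ring
  have hc3 : (((e - 1 : ℕ) : ℤ)) = (e : ℤ) - 1 := by rw [Nat.cast_sub he1, Nat.cast_one]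
  rw [hc1, hc2, hc3]
  by_contra hge
  rw [not_lt] at hge
  exact absurd (hshape.mp hge) (not_le.mpr hlt)

end Summit.ABC.IUTFork.Thm311.Real

end
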